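import Mathlib.Combinatorics.SetFamily.FourFunctions

/-!
# Marica–Schönheim-tight families: the projection identity

For a family `F` of finite sets and an element `r`, write `F₀` for the members avoiding `r`,
`Fr'` for the members containing `r` with `r` removed, `F' = F₀ ∪ Fr'` (the projection) and
`K = F₀ ∩ Fr'` (the members whose `r`-partner is also a member). The difference family
`F \\ F = {A \ B}` splits by whether `r ∈ A \ B`:

* `diffs_filter_not_mem`: the differences avoiding `r` are `X := F₀ \\ F₀ ∪ Fr' \\ Fr' ∪ F₀ \\ Fr'`;
* `diffs_filter_mem`: the differences containing `r` are `insert r` of `Y := Fr' \\ F₀`;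
* `F' \\ F' = X ∪ Y` and `K \\ K ⊆ X ∩ Y`, so
  `|F \\ F| = |F' \\ F'| + |X ∩ Y| ≥ |F' \\ F'| + |K \\ K|`.

With Marica–Schönheim (`Finset.card_le_card_diffs`) and `|F| = |F'| + |K|` this gives the
**equality structure of a tight family** (`|F \\ F| = |F|`): the projection `F'` and the partner
family `K` are tight, and `X ∩ Y = K \\ K` — a difference `E` of the projection has BOTH lifts
`E`, `insert r E` in `F \\ F` exactly when `E ∈ K \\ K` (`mem_diffs_partner_of_both`).
-/

namespace PercRepro.MSTight

open Finset
open scoped FinsetFamily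

variable {α : Type*} [DecidableEq α]

/-- The members of `F` avoiding `r`. -/
def part0 (r : α) (F : Finset (Finset α)) : Finset (Finset α) := F.filter fun A => r ∉ A

/-- The members of `F` containing `r`, with `r` removed. -/
def partr (r : α) (F : Finset (Finset α)) : Finset (Finset α) :=
  (F.filter fun A => r ∈ A).image fun A => A.erase r

/-- The projection of `F` along `r`: every member with `r` removed. -/
def proj (r : α) (F : Finset (Finset α)) : Finset (Finset α) := F.image fun A => A.erase r

/-- The partner family: members avoiding `r` whose `r`-partner is also a member. -/
def partner (r : α) (F : Finset (Finset α)) : Finset (Finset α) := part0 r F ∩ partr r F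

/-- Membership in `part0`. -/
theorem mem_part0 {r : α} {F : Finset (Finset α)} {A : Finset α} :
    A ∈ part0 r F ↔ A ∈ F ∧ r ∉ A := by simp [part0]

/-- Membership in `partr`: `A ∈ partr r F` iff `r ∉ A` and `insert r A ∈ F`. -/
theorem mem_partr {r : α} {F : Finset (Finset α)} {A : Finset α} :
    A ∈ partr r F ↔ r ∉ A ∧ insert r A ∈ F := by
  simp only [partr, Finset.mem_image, Finset.mem_filter]
  constructor
  · rintro ⟨B, ⟨hB, hrB⟩, rfl⟩
    exact ⟨Finset.notMem_erase r B, by rw [Finset.insert_erase hrB]; exact hB⟩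
  · rintro ⟨hrA, hA⟩
    exact ⟨insert r A, ⟨hA, Finset.mem_insert_self r A⟩, Finset.erase_insert hrA⟩

/-- Membership in the projection. -/
theorem mem_proj {r : α} {F : Finset (Finset α)} {A : Finset α} :
    A ∈ proj r F ↔ ∃ B ∈ F, B.erase r = A := by simp [proj]

/-- The projection is the union of the two parts. -/
theorem proj_eq_union (r : α) (F : Finset (Finset α)) : proj r F = part0 r F ∪ partr r F := by
  ext A
  simp only [mem_proj, Finset.mem_union, mem_part0, mem_partr]
  constructor
  · rintro ⟨B, hB, rfl⟩
    by_cases h : r ∈ B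
    · right
      exact ⟨Finset.notMem_erase r B, by rw [Finset.insert_erase h]; exact hB⟩
    · left
      rw [Finset.erase_eq_of_notMem h]
      exact ⟨hB, h⟩
  · rintro (⟨hA, hr⟩ | ⟨hr, hA⟩)
    · exact ⟨A, hA, Finset.erase_eq_of_notMem hr⟩
    · exact ⟨insert r A, hA, Finset.erase_insert hr⟩

/-- Members of the partner family avoid `r`. -/
theorem not_mem_of_mem_partner {r : α} {F : Finset (Finset α)} {A : Finset α}
    (h : A ∈ partner r F) : r ∉ A := (mem_part0.1 (Finset.mem_inter.1 h).1).2

/-- `|F| = |proj r F| + |partner r F|`. -/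
theorem card_eq_card_proj_add_card_partner (r : α) (F : Finset (Finset α)) :
    F.card = (proj r F).card + (partner r F).card := by
  have h1 : F.card = (part0 r F).card + (F.filter fun A => r ∈ A).card := by
    rw [part0, add_comm, Finset.card_filter_add_card_filter_not]
  have h2 : (F.filter fun A => r ∈ A).card = (partr r F).card := by
    rw [partr, Finset.card_image_of_injOn]
    intro A hA B hB hAB
    simp only [Finset.coe_filter, Set.mem_setOf_eq] at hA hB
    have hAB' : A.erase r = B.erase r := hAB
    rw [← Finset.insert_erase hA.2, ← Finset.insert_erase hB.2, hAB']
  rw [proj_eq_union, partner, Finset.card_union_add_card_inter, h1, h2]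

/-- The differences avoiding `r`: `X = F₀ \\ F₀ ∪ Fr' \\ Fr' ∪ F₀ \\ Fr'`. -/
def diffsX (r : α) (F : Finset (Finset α)) : Finset (Finset α) :=
  part0 r F \\ part0 r F ∪ partr r F \\ partr r F ∪ part0 r F \\ partr r F

/-- The differences containing `r`, with `r` removed: `Y = Fr' \\ F₀`. -/
def diffsY (r : α) (F : Finset (Finset α)) : Finset (Finset α) := partr r F \\ part0 r F

/-- Every member of `X` avoids `r`. -/
theorem notMem_of_mem_diffsX {r : α} {F : Finset (Finset α)} {E : Finset α}
    (h : E ∈ diffsX r F) : r ∉ E := by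
  simp only [diffsX, Finset.mem_union, Finset.mem_diffs] at h
  rcases h with (⟨A, hA, B, hB, rfl⟩ | ⟨A, hA, B, hB, rfl⟩) | ⟨A, hA, B, hB, rfl⟩
  · exact fun h => (mem_part0.1 hA).2 (Finset.mem_sdiff.1 h).1
  · exact fun h => (mem_partr.1 hA).1 (Finset.mem_sdiff.1 h).1
  · exact fun h => (mem_part0.1 hA).2 (Finset.mem_sdiff.1 h).1

/-- Every member of `Y` avoids `r`. -/
theorem notMem_of_mem_diffsY {r : α} {F : Finset (Finset α)} {E : Finset α}
    (h : E ∈ diffsY r F) : r ∉ E := by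
  simp only [diffsY, Finset.mem_diffs] at h
  obtain ⟨A, hA, B, hB, rfl⟩ := h
  exact fun h => (mem_partr.1 hA).1 (Finset.mem_sdiff.1 h).1

/-- **The differences of `F` avoiding `r` are exactly `X`.** -/
theorem diffs_filter_notMem (r : α) (F : Finset (Finset α)) :
    (F \\ F).filter (fun E => r ∉ E) = diffsX r F := by
  ext E
  simp only [Finset.mem_filter, Finset.mem_diffs, diffsX, Finset.mem_union, mem_part0, mem_partr]
  constructor
  · rintro ⟨⟨A, hA, B, hB, rfl⟩, hr⟩
    by_cases hrA : r ∈ A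
    · -- then `r ∈ B`, and `A \ B = (A.erase r) \ (B.erase r)`
      have hrB : r ∈ B := by
        by_contra hrB
        exact hr (Finset.mem_sdiff.2 ⟨hrA, hrB⟩)
      left; right
      refine ⟨A.erase r, ⟨Finset.notMem_erase r A, by rw [Finset.insert_erase hrA]; exact hA⟩,
        B.erase r, ⟨Finset.notMem_erase r B, by rw [Finset.insert_erase hrB]; exact hB⟩, ?_⟩
      ext x
      simp only [Finset.mem_sdiff, Finset.mem_erase]
      constructor
      · rintro ⟨⟨hxr, hxA⟩, hxB⟩
        exact ⟨hxA, fun h => hxB ⟨hxr, h⟩⟩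
      · rintro ⟨hxA, hxB⟩
        have hxr : x ≠ r := by rintro rfl; exact hxB hrB
        exact ⟨⟨hxr, hxA⟩, fun h => hxB h.2⟩
    · by_cases hrB : r ∈ B
      · -- `A \ B = A \ (B.erase r)`
        right
        refine ⟨A, ⟨hA, hrA⟩, B.erase r,
          ⟨Finset.notMem_erase r B, by rw [Finset.insert_erase hrB]; exact hB⟩, ?_⟩
        ext x
        simp only [Finset.mem_sdiff, Finset.mem_erase]
        constructor
        · rintro ⟨hxA, hxB⟩
          have hxr : x ≠ r := by rintro rfl; exact hrA hxA
          exact ⟨hxA, fun h => hxB ⟨hxr, h⟩⟩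
        · rintro ⟨hxA, hxB⟩
          exact ⟨hxA, fun h => hxB h.2⟩
      · left; left
        exact ⟨A, ⟨hA, hrA⟩, B, ⟨hB, hrB⟩, rfl⟩
  · rintro ((⟨A, ⟨hA, hrA⟩, B, ⟨hB, hrB⟩, rfl⟩ | ⟨A, ⟨hrA, hA⟩, B, ⟨hrB, hB⟩, rfl⟩) |
      ⟨A, ⟨hA, hrA⟩, B, ⟨hrB, hB⟩, rfl⟩)
    · exact ⟨⟨A, hA, B, hB, rfl⟩, fun h => hrA (Finset.mem_sdiff.1 h).1⟩
    · refine ⟨⟨insert r A, hA, insert r B, hB, ?_⟩, fun h => hrA (Finset.mem_sdiff.1 h).1⟩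
      ext x
      simp only [Finset.mem_sdiff, Finset.mem_insert]
      constructor
      · rintro ⟨(rfl | hxA), hxB⟩
        · exact absurd (Or.inl rfl) hxB
        · exact ⟨hxA, fun h => hxB (Or.inr h)⟩
      · rintro ⟨hxA, hxB⟩
        have hxr : x ≠ r := by rintro rfl; exact hrA hxA
        exact ⟨Or.inr hxA, fun h => h.elim hxr hxB⟩
    · refine ⟨⟨A, hA, insert r B, hB, ?_⟩, fun h => hrA (Finset.mem_sdiff.1 h).1⟩
      ext x
      simp only [Finset.mem_sdiff, Finset.mem_insert]
      constructor
      · rintro ⟨hxA, hxB⟩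
        exact ⟨hxA, fun h => hxB (Or.inr h)⟩
      · rintro ⟨hxA, hxB⟩
        have hxr : x ≠ r := by rintro rfl; exact hrA hxA
        exact ⟨hxA, fun h => h.elim hxr hxB⟩

/-- **The differences of `F` containing `r` are `insert r` of `Y`.** -/
theorem diffs_filter_mem (r : α) (F : Finset (Finset α)) :
    (F \\ F).filter (fun E => r ∈ E) = (diffsY r F).image (insert r) := by
  ext E
  simp only [Finset.mem_filter, Finset.mem_diffs, diffsY, Finset.mem_image, mem_part0, mem_partr]
  constructor
  · rintro ⟨⟨A, hA, B, hB, rfl⟩, hr⟩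
    have hrA : r ∈ A := (Finset.mem_sdiff.1 hr).1
    have hrB : r ∉ B := (Finset.mem_sdiff.1 hr).2
    refine ⟨A.erase r \ B, ⟨A.erase r,
      ⟨Finset.notMem_erase r A, by rw [Finset.insert_erase hrA]; exact hA⟩, B, ⟨hB, hrB⟩, rfl⟩, ?_⟩
    ext x
    simp only [Finset.mem_insert, Finset.mem_sdiff, Finset.mem_erase]
    constructor
    · rintro (rfl | ⟨⟨-, hxA⟩, hxB⟩)
      · exact ⟨hrA, hrB⟩
      · exact ⟨hxA, hxB⟩
    · rintro ⟨hxA, hxB⟩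
      by_cases hxr : x = r
      · exact Or.inl hxr
      · exact Or.inr ⟨⟨hxr, hxA⟩, hxB⟩
  · rintro ⟨E', ⟨A, ⟨hrA, hA⟩, B, ⟨hB, hrB⟩, rfl⟩, rfl⟩
    refine ⟨⟨insert r A, hA, B, hB, ?_⟩, Finset.mem_insert_self r _⟩
    ext x
    simp only [Finset.mem_sdiff, Finset.mem_insert]
    constructor
    · rintro ⟨(rfl | hxA), hxB⟩
      · exact Or.inl rfl
      · exact Or.inr ⟨hxA, hxB⟩
    · rintro (rfl | ⟨hxA, hxB⟩)
      · exact ⟨Or.inl rfl, hrB⟩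
      · exact ⟨Or.inr hxA, hxB⟩

/-- `|F \\ F| = |X| + |Y|`. -/
theorem card_diffs_eq_card_X_add_card_Y (r : α) (F : Finset (Finset α)) :
    (F \\ F).card = (diffsX r F).card + (diffsY r F).card := by
  rw [← Finset.card_filter_add_card_filter_not (fun E : Finset α => r ∉ E) (s := F \\ F),
    diffs_filter_notMem]
  congr 1
  have : (F \\ F).filter (fun E : Finset α => ¬ r ∉ E) = (F \\ F).filter (fun E => r ∈ E) := by
    apply Finset.filter_congr
    intro E _
    exact not_not
  rw [this, diffs_filter_mem, Finset.card_image_of_injOn]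
  intro E hE E' hE' h
  have h1 : r ∉ E := notMem_of_mem_diffsY hE
  have h2 : r ∉ E' := notMem_of_mem_diffsY hE'
  have h' : insert r E = insert r E' := h
  rw [← Finset.erase_insert h1, ← Finset.erase_insert h2, h']

/-- The differences of the projection are `X ∪ Y`. -/
theorem diffs_proj_eq (r : α) (F : Finset (Finset α)) :
    proj r F \\ proj r F = diffsX r F ∪ diffsY r F := by
  rw [proj_eq_union, Finset.diffs_union_left, Finset.diffs_union_right, Finset.diffs_union_right,
    diffsX, diffsY]
  ext E
  simp only [Finset.mem_union]
  tauto

/-- The differences of the partner family lie in `X ∩ Y`. -/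
theorem diffs_partner_subset (r : α) (F : Finset (Finset α)) :
    partner r F \\ partner r F ⊆ diffsX r F ∩ diffsY r F := by
  intro E hE
  obtain ⟨A, hA, B, hB, rfl⟩ := Finset.mem_diffs.1 hE
  rw [partner, Finset.mem_inter] at hA hB
  refine Finset.mem_inter.2 ⟨?_, ?_⟩
  · exact Finset.mem_union.2 (Or.inl (Finset.mem_union.2 (Or.inl
      (Finset.mem_diffs.2 ⟨A, hA.1, B, hB.1, rfl⟩))))
  · exact Finset.mem_diffs.2 ⟨A, hA.2, B, hB.1, rfl⟩

/-- `|F \\ F| = |proj r F \\ proj r F| + |X ∩ Y|`. -/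
theorem card_diffs_eq_card_diffs_proj_add (r : α) (F : Finset (Finset α)) :
    (F \\ F).card = (proj r F \\ proj r F).card + (diffsX r F ∩ diffsY r F).card := by
  rw [card_diffs_eq_card_X_add_card_Y, diffs_proj_eq, Finset.card_union_add_card_inter]

/-- A family is **tight** when Marica–Schönheim is an equality: `|F \\ F| = |F|`. -/
def Tight (F : Finset (Finset α)) : Prop := (F \\ F).card = F.card

/-- **The equality structure of a tight family** (Cor. 2): the projection and the partner family
are tight and `X ∩ Y` is exactly the difference family of the partner family. -/
theorem tight_proj_and_partner {r : α} {F : Finset (Finset α)} (hF : Tight F) :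
    Tight (proj r F) ∧ Tight (partner r F) ∧
      diffsX r F ∩ diffsY r F = partner r F \\ partner r F := by
  have h1 := card_diffs_eq_card_diffs_proj_add r F
  have h2 := card_eq_card_proj_add_card_partner r F
  have h3 : (proj r F).card ≤ (proj r F \\ proj r F).card := Finset.card_le_card_diffs _
  have h4 : (partner r F).card ≤ (partner r F \\ partner r F).card :=
    Finset.card_le_card_diffs _
  have h5 : (partner r F \\ partner r F).card ≤ (diffsX r F ∩ diffsY r F).card :=
    Finset.card_le_card (diffs_partner_subset r F)
  unfold Tight at hF
  refine ⟨?_, ?_, ?_⟩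
  · unfold Tight; omega
  · unfold Tight; omega
  · exact (Finset.eq_of_subset_of_card_le (diffs_partner_subset r F) (by omega)).symm

/-- In a tight family, a difference `E ∌ r` whose lift `insert r E` is also a difference is a
difference of two partner members. -/
theorem mem_diffs_partner_of_both {r : α} {F : Finset (Finset α)} (hF : Tight F) {E : Finset α}
    (hr : r ∉ E) (hE : E ∈ F \\ F) (hE' : insert r E ∈ F \\ F) :
    E ∈ partner r F \\ partner r F := by
  rw [← (tight_proj_and_partner hF).2.2, Finset.mem_inter]
  constructor
  · rw [← diffs_filter_notMem, Finset.mem_filter]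
    exact ⟨hE, hr⟩
  · have : insert r E ∈ (F \\ F).filter (fun E => r ∈ E) :=
      Finset.mem_filter.2 ⟨hE', Finset.mem_insert_self r E⟩
    rw [diffs_filter_mem, Finset.mem_image] at this
    obtain ⟨E', hE'', h⟩ := this
    have h1 : r ∉ E' := notMem_of_mem_diffsY hE''
    have : E' = E := by rw [← Finset.erase_insert h1, h, Finset.erase_insert hr]
    rw [← this]
    exact hE''

/-- In a tight family with empty partner family, `{r}` is not a difference (the unique lift of
`∅`). -/
theorem singleton_notMem_diffs {r : α} {F : Finset (Finset α)} (hF : Tight F)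
    (hK : partner r F = ∅) (hne : F.Nonempty) : ({r} : Finset α) ∉ F \\ F := by
  intro h
  obtain ⟨A, hA⟩ := hne
  have h0 : (∅ : Finset α) ∈ F \\ F := Finset.mem_diffs.2 ⟨A, hA, A, hA, Finset.sdiff_self A⟩
  have := mem_diffs_partner_of_both hF (Finset.notMem_empty r) h0 (by simpa using h)
  rw [hK] at this
  simp at this

end PercRepro.MSTight
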